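/-
Origin: written from primary sources — A. Weil, *Sur certains groupes d'opérateurs unitaires*, Acta Math. 111 (1964) Chap. III
n° 41, Lemme 5 p. 194 (majorants on compact sets), Théorème 6 (1) p. 193; R. Howe, *θ-series and invariant theory* (1979) §3;
S. Kudla, *Seesaw dual reductive pairs* (1984) §1; S. Gelbart, J. Rogawski, Invent. Math. 105 (1991) §3.1 Prop. 3.1.1 p. 455,
Remark p. 457 L4–13 (normalisation of a splitting by a character). Adapted: no. This file carries the `(34)` majorant
dischargers `hasThetaMajorants_seesawConjRep₁/₂` of `UnitaryDualPairSeesawConjMajorants` to the CM-lines currency of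
`UnitaryDualPairSeesawCMLines` (`cmLineRepRaw₀/₁`, `cmLineRep₀/₁ η_k`, `cmLineRepFin₀/₁ η_k`; plane `diag(a₀,a₁)`, `g = 1`,
`C = 1`) and removes every majorant hypothesis by the sign-fact producers of `Weil1964.ArchDualPairThetaMajorants`.
Kernel only; no records; nothing cited as a hypothesis.
-/
import Literature.NumberTheory.GelbartRogawski1991.UnitaryDualPairSeesawCMLines
import Literature.NumberTheory.GelbartRogawski1991.UnitaryDualPairSeesawConjMajorants
import Literature.NumberTheory.GelbartRogawski1991.UnitaryDualPairSeesawSmallMajorants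
import Literature.NumberTheory.Weil1964.ArchDualPairThetaMajorants
import HarnessLib

/-!
# Weil majorants for the CM line representations `cmLineRep{Raw,,Fin}₀/₁` (the `(34)` see-saw at `g = 1`)

Setting of `UnitaryDualPairSeesawCMLines`: a CM field `L` (`L⁺ = maximalRealSubfield L`, `c = complexConj`), a diagonal
hermitian space `V = diag(dV)` of rank `N`, a diagonal hermitian PLANE `W = diag(a₀, a₁) = ⟨a₀⟩ ⊕ ⟨a₁⟩`, the chosen compatible
splittings `splittingOf hGR`, `splittingOf hGR₀`, `splittingOf hGR₁` of the big pair `(U(V), U(W))` and of the two line pairs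
`(U(V), U(⟨a_k⟩))` ([GelbartRogawski1991, Prop. 3.1.1]), and the line representations of the Hodge-CM period packet:
`cmLineRepRaw_k = ω_k″` (K-1's renormalised `seesawConjRep₁/₂` at `g = 1`, `C = 1`), `cmLineRep_k η_k = η_k • (ω_k″ ∘ (id × centre))`
on `U(V)(𝔸) × U(1)(𝔸)`, `cmLineRepFin_k η_k` = the same on `U(V)(𝔸) × ker N_{L/L⁺}` acting on `𝒮(𝔸^{n₁})` (`R_{e₁}`-conjugate).

* §0 two continuity facts of the carriers: **`continuous_adelicCenter`** (`u ↦ u · 1_N : U(1)(𝔸) → U(J)(𝔸)`) and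
  **`continuous_cmAdelicOneEquivRelNormOne_symm`** (`ker N_{L/L⁺} ≃ U(1)(𝔸_{L⁺})`, same underlying idèle);
* §1 two transport lemmas for Weil's majorants [Weil1964, Lemme 5]: **`hasThetaMajorants_twist_comp_center`** (pull back along
  `id × centre`, twist by a character with continuous values: `HasThetaMajorants.comp` + `.smul`) and
  **`hasThetaMajorants_reindexConj_comp_relNormOne`** (pull back along `id × (ker N ≃ U(1))`, conjugate by `R_{e₁}`:
  `.comp` + `.reindexConj`);
* §2 the CM-lines currency of the `(34)` dischargers: **`hasThetaMajorants_cmLineRepRaw₀/₁`** (= `hM₃`/`hM₄` of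
  `UnitaryDualPairSeesawConjMajorants` at the CM data) from the three CM-currency majorant hypotheses `hρ` (big pair
  `ω_ψ ∘ s_pair`, the shape of `cmThetaKernelDatum`), `hρ₀`, `hρ₁` (line pairs, K-1's `pairSmall` shape) — the hypothesis block
  of `UnitaryDualPairSeesawCMLinesDeepLevelFixed` verbatim; then **`hasThetaMajorants_cmLineRep₀/₁`** (+ `Continuous η_k`) and
  **`hasThetaMajorants_cmLineRepFin₀/₁`**;
* §3 NO MAJORANT HYPOTHESIS LEFT: **`hasThetaMajorants_omega_pairSmall₁/₂_lineVec_of_signs`** — the line-pair hypotheses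
  `hρ₀`/`hρ₁` from the sign facts `(ι₁, h₁V, hV)` of `V` alone (a LINE `⟨x⟩`, `x = x̄ ≠ 0`, has a strict sign through every
  complex embedding: `Weil1964.re_apply_ne_zero_of_complexConj_eq`; producers `Weil1964.hasThetaMajorants_cmPairSplitting_of_signs`
  at `M = 1` and `hasThetaMajorants_omega_pairSmall₁/₂`), and **`hasThetaMajorants_cmLineRepFin₀/₁_of_signs`**: Weil majorants
  for `cmLineRepFin_k η_k` from `(ι₁, h₁V, h₁W, hV)` (`V` of signature `(N−1,1)`/`(1,N−1)` and `W` definite through `ι₁`, `V`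
  definite through every other embedding — the sign binders of the Hodge-CM `W`-block `wmInputCM₂s`) and `Continuous η_k`,
  the big-pair hypothesis being `Weil1964.hasThetaMajorants_cmPairSplitting_of_signs_two`.

Provenance / use (Hodge-CM model-construction cell, BINDER-OWNERS rows `real34` / `S`): the S-side line representations
`((S V c).P k).ω = lineRepOf k`, `k = 0, 1` (`HodgeCM/Model/ArchSideTerm.lean`) are `cmLineRepFin₀/₁ η₀/η₁` pulled back along the
continuous inclusion `regimeSubgroup ↪ U(diag dV)(𝔸)`; §3 is the tree supply for the MAJORANT field of `restrictTwist (lineRepOf k)`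
(`HasThetaMajorants.comp`). Lines `k = 2, 3`: `UnitaryDualPairSeesawCMLinesConjMajorants`. Nothing here is a claim of the
manuscripts under adjudication: kernel analysis over the tree's constructed objects.
-/

set_option autoImplicit false

noncomputable section

open scoped Matrix Kronecker Topology
open NumberField
open Literature.RepresentationTheory Literature.RepresentationTheory.SeesawScalar
open Literature.NumberTheory.Automorphic
open Literature.NumberTheory.Automorphic.UnitaryGroup
open Literature.NumberTheory.Weil1964

/-! ## §0 Continuity of the centre embedding and of the norm-one identification -/

namespace Literature.NumberTheory.GelbartRogawski1991

namespace UnitaryDualPair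

/-- **`u ↦ u · 1_N : U(1)(𝔸_F) → U(J)(𝔸_F)` (`UnitaryGroup.adelicCenter`) is continuous** (`Units.map` of the continuous
`Matrix.scalar`; both carriers carry the subgroup topologies). [folklore] -/
theorem continuous_adelicCenter (F E : Type) [Field F] [Field E] [NumberField E] [Algebra F E] (c : E ≃ₐ[F] E) (N : ℕ)
    (J : Matrix (Fin N) (Fin N) E) : Continuous (adelicCenter F E c N J) := by
  have h : Continuous fun u : ↥(adelicOne F E c) =>
      Units.map ((Matrix.scalar (Fin N) : AdeleRing (𝓞 E) E →+* Matrix (Fin N) (Fin N) (AdeleRing (𝓞 E) E)) :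
          AdeleRing (𝓞 E) E →* Matrix (Fin N) (Fin N) (AdeleRing (𝓞 E) E)) (u : (AdeleRing (𝓞 E) E)ˣ) :=
    (Continuous.units_map _ ((continuous_pi fun _ => continuous_id).matrix_diagonal)).comp continuous_subtype_val
  exact continuous_induced_rng.2 h

/-- **`(ker N_{L/L⁺} ≃ U(1)(𝔸_{L⁺}))` is continuous** — the inverse of `cmAdelicOneEquivRelNormOne` (same underlying idèles, both
topologies induced from `𝔸_Lˣ`; companion of `continuous_cmAdelicOneEquivRelNormOne`). [folklore] -/
theorem continuous_cmAdelicOneEquivRelNormOne_symm (L : Type) [Field L] [NumberField L] [IsCMField L] :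
    Continuous (cmAdelicOneEquivRelNormOne L).symm :=
  continuous_induced_rng.2 continuous_subtype_val

/-! ## §1 Two transports of Weil's majorants (centre pull-back + twist; norm-one pull-back + re-indexing) -/
section Transport

variable (L : Type) [Field L] [NumberField L] [IsCMField L] {N M n₁ : ℕ} (e₁ : Fin N × Fin 1 ≃ Fin n₁)
  (dV : Fin N → L) (d : Fin M → L)

/-- **centre pull-back + character twist**: if `(v, u′) ↦ ρ(v, u′)` on `U(diag dV)(𝔸) × U(diag d)(𝔸)` has Weil majorants and
`η₀ : U(diag dV)(𝔸) × U(1)(𝔸) → ℂˣ` has continuous values, then `(v, u) ↦ η₀(v,u) • ρ(v, u · 1)` has Weil majorants.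
[cite: Weil1964, Chap. III n° 41 Lemme 5 p. 194] -/
theorem hasThetaMajorants_twist_comp_center
    {ρ : Representation ℂ (CMAdelic L dV × CMAdelic L d) (piSchwartzBruhat (↥(maximalRealSubfield L)) (Fin N × Fin 1))}
    (hρ : HasThetaMajorants fun (p : CMAdelic L dV × CMAdelic L d)
      (Φ : piSchwartzBruhat (↥(maximalRealSubfield L)) (Fin N × Fin 1)) => ρ p Φ)
    (η₀ : CMAdelic L dV × CMAdelicOne L →* ℂˣ) (hη₀ : Continuous fun p => ((η₀ p : ℂˣ) : ℂ)) :
    HasThetaMajorants fun (p : CMAdelic L dV × CMAdelicOne L)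
      (Φ : piSchwartzBruhat (↥(maximalRealSubfield L)) (Fin N × Fin 1)) =>
        twist η₀ (ρ.comp ((MonoidHom.id _).prodMap (CMCenter L d))) p Φ := by
  have hf : Continuous fun p : CMAdelic L dV × CMAdelicOne L => ((MonoidHom.id _).prodMap (CMCenter L d)) p :=
    continuous_fst.prodMk
      ((continuous_adelicCenter (↥(maximalRealSubfield L)) L (IsCMField.complexConj L) M (Matrix.diagonal d)).comp
        continuous_snd)
  exact (hρ.comp hf).smul hη₀

/-- **norm-one pull-back + re-indexing**: if `(v, u) ↦ ρ(v, u)` on `U(diag dV)(𝔸) × U(1)(𝔸)` has Weil majorants on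
`𝒮(𝔸^{N × 1})`, then `(v, t) ↦ R_{e₁} ∘ ρ(v, u(t)) ∘ R_{e₁}⁻¹` on `U(diag dV)(𝔸) × ker N_{L/L⁺}` has Weil majorants on `𝒮(𝔸^{n₁})`.
[cite: Weil1964, Chap. III n° 41 Lemme 5 p. 194] -/
theorem hasThetaMajorants_reindexConj_comp_relNormOne
    {ρ : Representation ℂ (CMAdelic L dV × CMAdelicOne L) (piSchwartzBruhat (↥(maximalRealSubfield L)) (Fin N × Fin 1))}
    (hρ : HasThetaMajorants fun (p : CMAdelic L dV × CMAdelicOne L)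
      (Φ : piSchwartzBruhat (↥(maximalRealSubfield L)) (Fin N × Fin 1)) => ρ p Φ) :
    HasThetaMajorants fun (p : CMAdelic L dV × ↥(relNormOneIdeles (↥(maximalRealSubfield L)) L))
      (φ : piSchwartzBruhat (↥(maximalRealSubfield L)) (Fin n₁)) =>
        ((piSBReindex (↥(maximalRealSubfield L)) e₁).conjRingEquiv.toMonoidHom.comp
          (ρ.comp ((MonoidHom.id _).prodMap (cmAdelicOneEquivRelNormOne L).symm.toMonoidHom))) p φ := by
  have hf : Continuous fun p : CMAdelic L dV × ↥(relNormOneIdeles (↥(maximalRealSubfield L)) L) =>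
      ((MonoidHom.id _).prodMap (cmAdelicOneEquivRelNormOne L).symm.toMonoidHom) p :=
    continuous_fst.prodMk ((continuous_cmAdelicOneEquivRelNormOne_symm L).comp continuous_snd)
  exact (hρ.comp hf).reindexConj e₁

end Transport

/-! ## §2 The `(34)` dischargers in CM-lines currency -/

section CMLines

variable (L : Type) [Field L] [NumberField L] [IsCMField L] {N n n₁ : ℕ}
  (e : Fin N × Fin 2 ≃ Fin n) (e₁ : Fin N × Fin 1 ≃ Fin n₁)
variable (dV : Fin N → L) (hdV : ∀ i, IsCMField.complexConj L (dV i) = dV i) (hdV0 : ∀ i, dV i ≠ 0)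
variable (a : Fin 2 → L) (ha : ∀ i, IsCMField.complexConj L (a i) = a i) (ha0 : ∀ i, a i ≠ 0)
variable (hGR : (cmSplittingDatum L e dV hdV hdV0 a ha ha0).CompatibleSplitting)
  (hGR₀ : (cmSplittingDatum L e₁ dV hdV hdV0 (lineVec L (a 0)) (fun _ => ha 0) (fun _ => ha0 0)).CompatibleSplitting)
  (hGR₁ : (cmSplittingDatum L e₁ dV hdV hdV0 (lineVec L (a 1)) (fun _ => ha 1) (fun _ => ha0 1)).CompatibleSplitting)
  (η₀ η₁ : CMAdelic L dV × CMAdelicOne L →* ℂˣ)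

/-! Weil's majorant hypotheses at the CM data (the block of `UnitaryDualPairSeesawCMLinesDeepLevelFixed`): `hρ` for the big pair
`ω_ψ ∘ s_pair` in the literal shape of `cmThetaKernelDatum` (delivered by `Weil1964.hasThetaMajorants_cmPairSplitting_of_signs_two`),
`hρ₀`, `hρ₁` for the two line pairs `ω ∘ pairSmall_j (splittingOf hGR_j)` in K-1's `pairSmall` shape (delivered by §3). -/
variable
  (hρ : HasThetaMajorants fun (p : CMAdelic L dV × CMAdelic L a)
      (Φ : piSchwartzBruhat (↥(maximalRealSubfield L)) (Fin n)) =>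
    adelicMpCont.omega (↥(maximalRealSubfield L)) (Fin n)
      (adelicGram (↥(maximalRealSubfield L)) e (realDiagonal L dV hdV) (realDiagonal L a ha))
      (cmPairSplitting L e dV hdV hdV0 a ha ha0 hGR p) Φ)
  (hρ₀ : HasThetaMajorants fun (p : CMAdelic L dV × CMAdelic L (lineVec L (a 0)))
      (Φ : piSchwartzBruhat (↥(maximalRealSubfield L)) (Fin N × Fin 1)) =>
    adelicMpCont.omega (↥(maximalRealSubfield L)) (Fin N × Fin 1)
      ((realDiagonal L dV hdV).map (algebraMap (↥(maximalRealSubfield L))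
          (AdeleRing (𝓞 ↥(maximalRealSubfield L)) ↥(maximalRealSubfield L))) ⊗ₖ
        (realDiagonal L (lineVec L (a 0)) fun _ => ha 0).map (algebraMap (↥(maximalRealSubfield L))
          (AdeleRing (𝓞 ↥(maximalRealSubfield L)) ↥(maximalRealSubfield L))))
      (pairSmall₁ (↥(maximalRealSubfield L)) L (IsCMField.complexConj L) N 1 e₁ (Matrix.diagonal dV)
        (Matrix.diagonal (lineVec L (a 0)))
        (splittingOf (↥(maximalRealSubfield L)) L (IsCMField.complexConj L) N 1 e₁ (Matrix.diagonal dV)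
          (Matrix.diagonal (lineVec L (a 0))) (complexConj_imagUnit L) (imagUnit_ne_zero L) (imagUnit_mul_self L)
          (realDiagonal_isSymm L dV hdV) (realDiagonal_isSymm L (lineVec L (a 0)) fun _ => ha 0)
          (isUnit_det_realDiagonal L dV hdV hdV0) (isUnit_det_realDiagonal L (lineVec L (a 0)) (fun _ => ha 0) fun _ => ha0 0)
          (realDiagonal_map L dV hdV).symm (realDiagonal_map L (lineVec L (a 0)) fun _ => ha 0).symm hGR₀) p) Φ)
  (hρ₁ : HasThetaMajorants fun (p : CMAdelic L dV × CMAdelic L (lineVec L (a 1)))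
      (Φ : piSchwartzBruhat (↥(maximalRealSubfield L)) (Fin N × Fin 1)) =>
    adelicMpCont.omega (↥(maximalRealSubfield L)) (Fin N × Fin 1)
      ((realDiagonal L dV hdV).map (algebraMap (↥(maximalRealSubfield L))
          (AdeleRing (𝓞 ↥(maximalRealSubfield L)) ↥(maximalRealSubfield L))) ⊗ₖ
        (realDiagonal L (lineVec L (a 1)) fun _ => ha 1).map (algebraMap (↥(maximalRealSubfield L))
          (AdeleRing (𝓞 ↥(maximalRealSubfield L)) ↥(maximalRealSubfield L))))
      (pairSmall₂ (↥(maximalRealSubfield L)) L (IsCMField.complexConj L) N 1 e₁ (Matrix.diagonal dV)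
        (Matrix.diagonal (lineVec L (a 1)))
        (splittingOf (↥(maximalRealSubfield L)) L (IsCMField.complexConj L) N 1 e₁ (Matrix.diagonal dV)
          (Matrix.diagonal (lineVec L (a 1))) (complexConj_imagUnit L) (imagUnit_ne_zero L) (imagUnit_mul_self L)
          (realDiagonal_isSymm L dV hdV) (realDiagonal_isSymm L (lineVec L (a 1)) fun _ => ha 1)
          (isUnit_det_realDiagonal L dV hdV hdV0) (isUnit_det_realDiagonal L (lineVec L (a 1)) (fun _ => ha 1) fun _ => ha0 1)
          (realDiagonal_map L dV hdV).symm (realDiagonal_map L (lineVec L (a 1)) fun _ => ha 1).symm hGR₁) p) Φ)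

include hρ hρ₀ hρ₁ in
/-- **`hM₃` at the CM data — Weil majorants for `ω₀″ = cmLineRepRaw₀`** (`hasThetaMajorants_seesawConjRep₁` at `g = 1`, `C = 1`).
[cite: Weil1964, Chap. III n° 41 Lemme 5 p. 194; GelbartRogawski1991, §3.1 p. 454, Remark p. 457] -/
theorem hasThetaMajorants_cmLineRepRaw₀ :
    HasThetaMajorants fun (p : CMAdelic L dV × CMAdelic L (lineVec L (a 0)))
      (Φ : piSchwartzBruhat (↥(maximalRealSubfield L)) (Fin N × Fin 1)) =>
        cmLineRepRaw₀ L e e₁ dV hdV hdV0 a ha ha0 hGR hGR₀ hGR₁ p Φ :=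
  hasThetaMajorants_seesawConjRep₁ (↥(maximalRealSubfield L)) L (IsCMField.complexConj L) N 1 1 e e₁ e₁ (Matrix.diagonal dV)
    (Matrix.diagonal a) (Matrix.diagonal (lineVec L (a 0))) (Matrix.diagonal (lineVec L (a 1)))
    (complexConj_imagUnit L) (imagUnit_ne_zero L) (imagUnit_mul_self L)
    (realDiagonal_isSymm L dV hdV) (realDiagonal_isSymm L a ha)
    (realDiagonal_isSymm L (lineVec L (a 0)) fun _ => ha 0) (realDiagonal_isSymm L (lineVec L (a 1)) fun _ => ha 1)
    (isUnit_det_realDiagonal L dV hdV hdV0) (isUnit_det_realDiagonal L a ha ha0)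
    (isUnit_det_realDiagonal L (lineVec L (a 0)) (fun _ => ha 0) fun _ => ha0 0)
    (isUnit_det_realDiagonal L (lineVec L (a 1)) (fun _ => ha 1) fun _ => ha0 1)
    ((Matrix.isUnit_iff_isUnit_det _).1
      (isUnit_kronecker_map (↥(maximalRealSubfield L)) N (isUnit_det_realDiagonal L dV hdV hdV0)
        (isUnit_det_realDiagonal L a ha ha0)))
    (realDiagonal_map L dV hdV).symm (realDiagonal_map L a ha).symm
    (realDiagonal_map L (lineVec L (a 0)) fun _ => ha 0).symm (realDiagonal_map L (lineVec L (a 1)) fun _ => ha 1).symm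
    (coe_one_GL_eq_map L (AdeleRing (𝓞 L) L) (Fin (1 + 1))) (adelicIsometry_one_lineVec L a)
    (coe_one_GL_eq_map (↥(maximalRealSubfield L)) (AdeleRing (𝓞 ↥(maximalRealSubfield L)) ↥(maximalRealSubfield L))
      (Fin N × Fin (1 + 1)))
    (gramIntertwiner_one_lineVec L a ha (realDiagonal L dV hdV))
    (splittingOf_isCompatible _ _ _ _ _ _ _ _ _ _ _ _ _ _ _ _ _ hGR)
    (splittingOf_isCompatible _ _ _ _ _ _ _ _ _ _ _ _ _ _ _ _ _ hGR₀)
    (splittingOf_isCompatible _ _ _ _ _ _ _ _ _ _ _ _ _ _ _ _ _ hGR₁) hρ hρ₀ hρ₁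

include hρ hρ₀ hρ₁ in
/-- **`hM₄` at the CM data — Weil majorants for `ω₁″ = cmLineRepRaw₁`** (`hasThetaMajorants_seesawConjRep₂` at `g = 1`, `C = 1`).
[cite: Weil1964, Chap. III n° 41 Lemme 5 p. 194; GelbartRogawski1991, §3.1 p. 454, Remark p. 457] -/
theorem hasThetaMajorants_cmLineRepRaw₁ :
    HasThetaMajorants fun (p : CMAdelic L dV × CMAdelic L (lineVec L (a 1)))
      (Φ : piSchwartzBruhat (↥(maximalRealSubfield L)) (Fin N × Fin 1)) =>
        cmLineRepRaw₁ L e e₁ dV hdV hdV0 a ha ha0 hGR hGR₀ hGR₁ p Φ :=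
  hasThetaMajorants_seesawConjRep₂ (↥(maximalRealSubfield L)) L (IsCMField.complexConj L) N 1 1 e e₁ e₁ (Matrix.diagonal dV)
    (Matrix.diagonal a) (Matrix.diagonal (lineVec L (a 0))) (Matrix.diagonal (lineVec L (a 1)))
    (complexConj_imagUnit L) (imagUnit_ne_zero L) (imagUnit_mul_self L)
    (realDiagonal_isSymm L dV hdV) (realDiagonal_isSymm L a ha)
    (realDiagonal_isSymm L (lineVec L (a 0)) fun _ => ha 0) (realDiagonal_isSymm L (lineVec L (a 1)) fun _ => ha 1)
    (isUnit_det_realDiagonal L dV hdV hdV0) (isUnit_det_realDiagonal L a ha ha0)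
    (isUnit_det_realDiagonal L (lineVec L (a 0)) (fun _ => ha 0) fun _ => ha0 0)
    (isUnit_det_realDiagonal L (lineVec L (a 1)) (fun _ => ha 1) fun _ => ha0 1)
    ((Matrix.isUnit_iff_isUnit_det _).1
      (isUnit_kronecker_map (↥(maximalRealSubfield L)) N (isUnit_det_realDiagonal L dV hdV hdV0)
        (isUnit_det_realDiagonal L a ha ha0)))
    (realDiagonal_map L dV hdV).symm (realDiagonal_map L a ha).symm
    (realDiagonal_map L (lineVec L (a 0)) fun _ => ha 0).symm (realDiagonal_map L (lineVec L (a 1)) fun _ => ha 1).symm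
    (coe_one_GL_eq_map L (AdeleRing (𝓞 L) L) (Fin (1 + 1))) (adelicIsometry_one_lineVec L a)
    (coe_one_GL_eq_map (↥(maximalRealSubfield L)) (AdeleRing (𝓞 ↥(maximalRealSubfield L)) ↥(maximalRealSubfield L))
      (Fin N × Fin (1 + 1)))
    (gramIntertwiner_one_lineVec L a ha (realDiagonal L dV hdV))
    (splittingOf_isCompatible _ _ _ _ _ _ _ _ _ _ _ _ _ _ _ _ _ hGR)
    (splittingOf_isCompatible _ _ _ _ _ _ _ _ _ _ _ _ _ _ _ _ _ hGR₀)
    (splittingOf_isCompatible _ _ _ _ _ _ _ _ _ _ _ _ _ _ _ _ _ hGR₁) hρ hρ₀ hρ₁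

include hρ hρ₀ hρ₁ in
/-- **Weil majorants for `cmLineRep₀ η₀ = η₀ • (ω₀″ ∘ (id × centre))`**, `η₀` with continuous values.
[cite: Weil1964, Chap. III n° 41 Lemme 5 p. 194; GelbartRogawski1991, §3.1 Remark p. 457 L4–13] -/
theorem hasThetaMajorants_cmLineRep₀ (hη₀ : Continuous fun p => ((η₀ p : ℂˣ) : ℂ)) :
    HasThetaMajorants fun (p : CMAdelic L dV × CMAdelicOne L)
      (Φ : piSchwartzBruhat (↥(maximalRealSubfield L)) (Fin N × Fin 1)) =>
        cmLineRep₀ L e e₁ dV hdV hdV0 a ha ha0 hGR hGR₀ hGR₁ η₀ p Φ :=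
  hasThetaMajorants_twist_comp_center L dV (lineVec L (a 0))
    (hasThetaMajorants_cmLineRepRaw₀ L e e₁ dV hdV hdV0 a ha ha0 hGR hGR₀ hGR₁ hρ hρ₀ hρ₁) η₀ hη₀

include hρ hρ₀ hρ₁ in
/-- **Weil majorants for `cmLineRep₁ η₁ = η₁ • (ω₁″ ∘ (id × centre))`**, `η₁` with continuous values.
[cite: Weil1964, Chap. III n° 41 Lemme 5 p. 194; GelbartRogawski1991, §3.1 Remark p. 457 L4–13] -/
theorem hasThetaMajorants_cmLineRep₁ (hη₁ : Continuous fun p => ((η₁ p : ℂˣ) : ℂ)) :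
    HasThetaMajorants fun (p : CMAdelic L dV × CMAdelicOne L)
      (Φ : piSchwartzBruhat (↥(maximalRealSubfield L)) (Fin N × Fin 1)) =>
        cmLineRep₁ L e e₁ dV hdV hdV0 a ha ha0 hGR hGR₀ hGR₁ η₁ p Φ :=
  hasThetaMajorants_twist_comp_center L dV (lineVec L (a 1))
    (hasThetaMajorants_cmLineRepRaw₁ L e e₁ dV hdV hdV0 a ha ha0 hGR hGR₀ hGR₁ hρ hρ₀ hρ₁) η₁ hη₁

include hρ hρ₀ hρ₁ in
/-- **Weil majorants for `cmLineRepFin₀ η₀`** on `U(diag dV)(𝔸) × ker N_{L/L⁺}` acting on `𝒮(𝔸^{n₁})`.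
[cite: Weil1964, Chap. III n° 41 Lemme 5 p. 194; GelbartRogawski1991, §3.1 Remark p. 457 L4–13] -/
theorem hasThetaMajorants_cmLineRepFin₀ (hη₀ : Continuous fun p => ((η₀ p : ℂˣ) : ℂ)) :
    HasThetaMajorants fun (p : CMAdelic L dV × ↥(relNormOneIdeles (↥(maximalRealSubfield L)) L))
      (φ : piSchwartzBruhat (↥(maximalRealSubfield L)) (Fin n₁)) =>
        cmLineRepFin₀ L e e₁ dV hdV hdV0 a ha ha0 hGR hGR₀ hGR₁ η₀ p φ :=
  hasThetaMajorants_reindexConj_comp_relNormOne L e₁ dV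
    (hasThetaMajorants_cmLineRep₀ L e e₁ dV hdV hdV0 a ha ha0 hGR hGR₀ hGR₁ η₀ hρ hρ₀ hρ₁ hη₀)

include hρ hρ₀ hρ₁ in
/-- **Weil majorants for `cmLineRepFin₁ η₁`** on `U(diag dV)(𝔸) × ker N_{L/L⁺}` acting on `𝒮(𝔸^{n₁})`.
[cite: Weil1964, Chap. III n° 41 Lemme 5 p. 194; GelbartRogawski1991, §3.1 Remark p. 457 L4–13] -/
theorem hasThetaMajorants_cmLineRepFin₁ (hη₁ : Continuous fun p => ((η₁ p : ℂˣ) : ℂ)) :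
    HasThetaMajorants fun (p : CMAdelic L dV × ↥(relNormOneIdeles (↥(maximalRealSubfield L)) L))
      (φ : piSchwartzBruhat (↥(maximalRealSubfield L)) (Fin n₁)) =>
        cmLineRepFin₁ L e e₁ dV hdV hdV0 a ha ha0 hGR hGR₀ hGR₁ η₁ p φ :=
  hasThetaMajorants_reindexConj_comp_relNormOne L e₁ dV
    (hasThetaMajorants_cmLineRep₁ L e e₁ dV hdV hdV0 a ha ha0 hGR hGR₀ hGR₁ η₁ hρ hρ₀ hρ₁ hη₁)

end CMLines

/-! ## §3 No majorant hypothesis left: everything from the sign facts `(ι₁, h₁V, h₁W, hV)` -/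

section SignsLine

variable (L : Type) [Field L] [NumberField L] [IsCMField L] {N n₁ : ℕ} (e₁ : Fin N × Fin 1 ≃ Fin n₁)
variable (dV : Fin N → L) (hdV : ∀ i, IsCMField.complexConj L (dV i) = dV i) (hdV0 : ∀ i, dV i ≠ 0)
  (x : L) (hx : IsCMField.complexConj L x = x) (hx0 : x ≠ 0)
  (hGRx : (cmSplittingDatum L e₁ dV hdV hdV0 (lineVec L x) (fun _ => hx) (fun _ => hx0)).CompatibleSplitting)

/-- **the line-pair hypothesis `hρ₀` from sign facts of `V` alone**: for a LINE `⟨x⟩` (`x = x̄ ≠ 0`) the pair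
`(U(diag dV), U(⟨x⟩))` is `U(N−1,1) × U(1)` or `U(1,N−1) × U(1)` through `ι₁` and compact `×` compact elsewhere, so
`Weil1964.hasThetaMajorants_cmPairSplitting_of_signs` applies with the line's own sign conditions automatic
(`re ι(x) ≠ 0`); read in K-1's `pairSmall₁` shape by `hasThetaMajorants_omega_pairSmall₁`.
[cite: Weil1964, Chap. III n° 41 Lemme 5 p. 194, Théorème 6 (1) p. 193; GelbartRogawski1991, §3.1 Prop. 3.1.1 p. 455] -/
theorem hasThetaMajorants_omega_pairSmall₁_lineVec_of_signs (ι₁ : L →+* ℂ)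
    (h₁V : ∃ i₀ : Fin N, (∀ i, i ≠ i₀ → 0 < (ι₁ (dV i)).re) ∨ ∀ i, i ≠ i₀ → (ι₁ (dV i)).re < 0)
    (hV : ∀ τ : L →+* ℂ, InfinitePlace.mk τ ≠ InfinitePlace.mk ι₁ →
      (∀ i, 0 < (τ (dV i)).re) ∨ ∀ i, (τ (dV i)).re < 0) :
    HasThetaMajorants fun (p : CMAdelic L dV × CMAdelic L (lineVec L x))
      (Φ : piSchwartzBruhat (↥(maximalRealSubfield L)) (Fin N × Fin 1)) =>
    adelicMpCont.omega (↥(maximalRealSubfield L)) (Fin N × Fin 1)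
      ((realDiagonal L dV hdV).map (algebraMap (↥(maximalRealSubfield L))
          (AdeleRing (𝓞 ↥(maximalRealSubfield L)) ↥(maximalRealSubfield L))) ⊗ₖ
        (realDiagonal L (lineVec L x) fun _ => hx).map (algebraMap (↥(maximalRealSubfield L))
          (AdeleRing (𝓞 ↥(maximalRealSubfield L)) ↥(maximalRealSubfield L))))
      (pairSmall₁ (↥(maximalRealSubfield L)) L (IsCMField.complexConj L) N 1 e₁ (Matrix.diagonal dV)
        (Matrix.diagonal (lineVec L x))
        (splittingOf (↥(maximalRealSubfield L)) L (IsCMField.complexConj L) N 1 e₁ (Matrix.diagonal dV)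
          (Matrix.diagonal (lineVec L x)) (complexConj_imagUnit L) (imagUnit_ne_zero L) (imagUnit_mul_self L)
          (realDiagonal_isSymm L dV hdV) (realDiagonal_isSymm L (lineVec L x) fun _ => hx)
          (isUnit_det_realDiagonal L dV hdV hdV0) (isUnit_det_realDiagonal L (lineVec L x) (fun _ => hx) fun _ => hx0)
          (realDiagonal_map L dV hdV).symm (realDiagonal_map L (lineVec L x) fun _ => hx).symm hGRx) p) Φ :=
  hasThetaMajorants_omega_pairSmall₁ (↥(maximalRealSubfield L)) L (IsCMField.complexConj L) N 1 e₁ (Matrix.diagonal dV)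
    (Matrix.diagonal (lineVec L x))
    (hasThetaMajorants_cmPairSplitting_of_signs L e₁ dV hdV hdV0 (lineVec L x) (fun _ => hx) (fun _ => hx0) ι₁ hGRx h₁V
      ((re_apply_ne_zero_of_complexConj_eq L ι₁ hx hx0).lt_or_gt.symm.imp (fun h _ => h) fun h _ => h) hV
      fun _ _ => Or.inl ⟨0, fun j hj => absurd (Subsingleton.elim j 0) hj⟩)

/-- the same in K-1's `pairSmall₂` shape (the hypothesis `hρ₁` of the second line).
[cite: Weil1964, Chap. III n° 41 Lemme 5 p. 194, Théorème 6 (1) p. 193; GelbartRogawski1991, §3.1 Prop. 3.1.1 p. 455] -/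
theorem hasThetaMajorants_omega_pairSmall₂_lineVec_of_signs (ι₁ : L →+* ℂ)
    (h₁V : ∃ i₀ : Fin N, (∀ i, i ≠ i₀ → 0 < (ι₁ (dV i)).re) ∨ ∀ i, i ≠ i₀ → (ι₁ (dV i)).re < 0)
    (hV : ∀ τ : L →+* ℂ, InfinitePlace.mk τ ≠ InfinitePlace.mk ι₁ →
      (∀ i, 0 < (τ (dV i)).re) ∨ ∀ i, (τ (dV i)).re < 0) :
    HasThetaMajorants fun (p : CMAdelic L dV × CMAdelic L (lineVec L x))
      (Φ : piSchwartzBruhat (↥(maximalRealSubfield L)) (Fin N × Fin 1)) =>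
    adelicMpCont.omega (↥(maximalRealSubfield L)) (Fin N × Fin 1)
      ((realDiagonal L dV hdV).map (algebraMap (↥(maximalRealSubfield L))
          (AdeleRing (𝓞 ↥(maximalRealSubfield L)) ↥(maximalRealSubfield L))) ⊗ₖ
        (realDiagonal L (lineVec L x) fun _ => hx).map (algebraMap (↥(maximalRealSubfield L))
          (AdeleRing (𝓞 ↥(maximalRealSubfield L)) ↥(maximalRealSubfield L))))
      (pairSmall₂ (↥(maximalRealSubfield L)) L (IsCMField.complexConj L) N 1 e₁ (Matrix.diagonal dV)
        (Matrix.diagonal (lineVec L x))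
        (splittingOf (↥(maximalRealSubfield L)) L (IsCMField.complexConj L) N 1 e₁ (Matrix.diagonal dV)
          (Matrix.diagonal (lineVec L x)) (complexConj_imagUnit L) (imagUnit_ne_zero L) (imagUnit_mul_self L)
          (realDiagonal_isSymm L dV hdV) (realDiagonal_isSymm L (lineVec L x) fun _ => hx)
          (isUnit_det_realDiagonal L dV hdV hdV0) (isUnit_det_realDiagonal L (lineVec L x) (fun _ => hx) fun _ => hx0)
          (realDiagonal_map L dV hdV).symm (realDiagonal_map L (lineVec L x) fun _ => hx).symm hGRx) p) Φ :=
  hasThetaMajorants_omega_pairSmall₂ (↥(maximalRealSubfield L)) L (IsCMField.complexConj L) N 1 e₁ (Matrix.diagonal dV)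
    (Matrix.diagonal (lineVec L x))
    (hasThetaMajorants_cmPairSplitting_of_signs L e₁ dV hdV hdV0 (lineVec L x) (fun _ => hx) (fun _ => hx0) ι₁ hGRx h₁V
      ((re_apply_ne_zero_of_complexConj_eq L ι₁ hx hx0).lt_or_gt.symm.imp (fun h _ => h) fun h _ => h) hV
      fun _ _ => Or.inl ⟨0, fun j hj => absurd (Subsingleton.elim j 0) hj⟩)

end SignsLine

section Signs

variable (L : Type) [Field L] [NumberField L] [IsCMField L] {N n n₁ : ℕ}
  (e : Fin N × Fin 2 ≃ Fin n) (e₁ : Fin N × Fin 1 ≃ Fin n₁)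
variable (dV : Fin N → L) (hdV : ∀ i, IsCMField.complexConj L (dV i) = dV i) (hdV0 : ∀ i, dV i ≠ 0)
variable (a : Fin 2 → L) (ha : ∀ i, IsCMField.complexConj L (a i) = a i) (ha0 : ∀ i, a i ≠ 0)
variable (hGR : (cmSplittingDatum L e dV hdV hdV0 a ha ha0).CompatibleSplitting)
  (hGR₀ : (cmSplittingDatum L e₁ dV hdV hdV0 (lineVec L (a 0)) (fun _ => ha 0) (fun _ => ha0 0)).CompatibleSplitting)
  (hGR₁ : (cmSplittingDatum L e₁ dV hdV hdV0 (lineVec L (a 1)) (fun _ => ha 1) (fun _ => ha0 1)).CompatibleSplitting)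
  (η₀ η₁ : CMAdelic L dV × CMAdelicOne L →* ℂˣ)

/-- **WEIL MAJORANTS FOR `cmLineRepFin₀ η₀` FROM SIGN FACTS** — no majorant hypothesis: `V` of signature `(N−1,1)` or `(1,N−1)`
and `W = diag(a₀,a₁)` definite through `ι₁`, `V` definite through every other complex embedding, `η₀` with continuous values.
[cite: Weil1964, Chap. III n° 41 Lemme 5 p. 194, Théorème 6 (1) p. 193; GelbartRogawski1991, §3.1 Prop. 3.1.1 p. 455, Remark p. 457] -/
theorem hasThetaMajorants_cmLineRepFin₀_of_signs (ι₁ : L →+* ℂ)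
    (h₁V : ∃ i₀ : Fin N, (∀ i, i ≠ i₀ → 0 < (ι₁ (dV i)).re) ∨ ∀ i, i ≠ i₀ → (ι₁ (dV i)).re < 0)
    (h₁W : (∀ j, 0 < (ι₁ (a j)).re) ∨ ∀ j, (ι₁ (a j)).re < 0)
    (hV : ∀ τ : L →+* ℂ, InfinitePlace.mk τ ≠ InfinitePlace.mk ι₁ →
      (∀ i, 0 < (τ (dV i)).re) ∨ ∀ i, (τ (dV i)).re < 0)
    (hη₀ : Continuous fun p => ((η₀ p : ℂˣ) : ℂ)) :
    HasThetaMajorants fun (p : CMAdelic L dV × ↥(relNormOneIdeles (↥(maximalRealSubfield L)) L))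
      (φ : piSchwartzBruhat (↥(maximalRealSubfield L)) (Fin n₁)) =>
        cmLineRepFin₀ L e e₁ dV hdV hdV0 a ha ha0 hGR hGR₀ hGR₁ η₀ p φ :=
  hasThetaMajorants_cmLineRepFin₀ L e e₁ dV hdV hdV0 a ha ha0 hGR hGR₀ hGR₁ η₀
    (hasThetaMajorants_cmPairSplitting_of_signs_two L e dV hdV hdV0 a ha ha0 ι₁ hGR h₁V h₁W hV)
    (hasThetaMajorants_omega_pairSmall₁_lineVec_of_signs L e₁ dV hdV hdV0 (a 0) (ha 0) (ha0 0) hGR₀ ι₁ h₁V hV)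
    (hasThetaMajorants_omega_pairSmall₂_lineVec_of_signs L e₁ dV hdV hdV0 (a 1) (ha 1) (ha0 1) hGR₁ ι₁ h₁V hV) hη₀

/-- **WEIL MAJORANTS FOR `cmLineRepFin₁ η₁` FROM SIGN FACTS.**
[cite: Weil1964, Chap. III n° 41 Lemme 5 p. 194, Théorème 6 (1) p. 193; GelbartRogawski1991, §3.1 Prop. 3.1.1 p. 455, Remark p. 457] -/
theorem hasThetaMajorants_cmLineRepFin₁_of_signs (ι₁ : L →+* ℂ)
    (h₁V : ∃ i₀ : Fin N, (∀ i, i ≠ i₀ → 0 < (ι₁ (dV i)).re) ∨ ∀ i, i ≠ i₀ → (ι₁ (dV i)).re < 0)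
    (h₁W : (∀ j, 0 < (ι₁ (a j)).re) ∨ ∀ j, (ι₁ (a j)).re < 0)
    (hV : ∀ τ : L →+* ℂ, InfinitePlace.mk τ ≠ InfinitePlace.mk ι₁ →
      (∀ i, 0 < (τ (dV i)).re) ∨ ∀ i, (τ (dV i)).re < 0)
    (hη₁ : Continuous fun p => ((η₁ p : ℂˣ) : ℂ)) :
    HasThetaMajorants fun (p : CMAdelic L dV × ↥(relNormOneIdeles (↥(maximalRealSubfield L)) L))
      (φ : piSchwartzBruhat (↥(maximalRealSubfield L)) (Fin n₁)) =>
        cmLineRepFin₁ L e e₁ dV hdV hdV0 a ha ha0 hGR hGR₀ hGR₁ η₁ p φ :=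
  hasThetaMajorants_cmLineRepFin₁ L e e₁ dV hdV hdV0 a ha ha0 hGR hGR₀ hGR₁ η₁
    (hasThetaMajorants_cmPairSplitting_of_signs_two L e dV hdV hdV0 a ha ha0 ι₁ hGR h₁V h₁W hV)
    (hasThetaMajorants_omega_pairSmall₁_lineVec_of_signs L e₁ dV hdV hdV0 (a 0) (ha 0) (ha0 0) hGR₀ ι₁ h₁V hV)
    (hasThetaMajorants_omega_pairSmall₂_lineVec_of_signs L e₁ dV hdV hdV0 (a 1) (ha 1) (ha0 1) hGR₁ ι₁ h₁V hV) hη₁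

end Signs

end UnitaryDualPair

end Literature.NumberTheory.GelbartRogawski1991

end

/-! ### Build-lane note (ops-buildfix G11b-3 recipe v2, LEDGER B13-1/B14-5/B14-7, 2026-08-22)
`lean -o` (the hub build lane, never `lean`/the gate check) runs Lean 4.32's library-suggestion indexers
(`Lean.LibrarySuggestions.SymbolFrequency` / `SineQuaNon`, from their `exportEntriesFn`) over the statement of every local
theorem constant that is not a denied premise; on this family's statements (very large dependent binder telescopes) that fold
runs for tens of minutes (incident G11b-3, run/shared/lean/ops/buildfix/G11b-3-DOSSIER.md). `isDeniedPremise` skips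
`[implicit_reducible]` constants before any fold, and the status is inert on theorems (Meta never unfolds `thmInfo`).
v2 form: ONE file-final, top-level `local` attribute — it goes through the synchronous scoped reducibility extension that
`getReducibilityStatusCore` reads first, so it needs no `set_option Elab.async false` (parallel elaboration stays on), also
reaches auto-realized `*.congr_simp` / structure-projection theorem constants, is never popped before export, and is not
exported. No statement or proof is changed. -/
set_option allowUnsafeReducibility true in
attribute [local implicit_reducible]
  Literature.NumberTheory.GelbartRogawski1991.UnitaryDualPair.continuous_adelicCenter
  Literature.NumberTheory.GelbartRogawski1991.UnitaryDualPair.continuous_cmAdelicOneEquivRelNormOne_symm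
  Literature.NumberTheory.GelbartRogawski1991.UnitaryDualPair.hasThetaMajorants_twist_comp_center
  Literature.NumberTheory.GelbartRogawski1991.UnitaryDualPair.hasThetaMajorants_reindexConj_comp_relNormOne
  Literature.NumberTheory.GelbartRogawski1991.UnitaryDualPair.hasThetaMajorants_cmLineRepRaw₀
  Literature.NumberTheory.GelbartRogawski1991.UnitaryDualPair.hasThetaMajorants_cmLineRepRaw₁
  Literature.NumberTheory.GelbartRogawski1991.UnitaryDualPair.hasThetaMajorants_cmLineRep₀
  Literature.NumberTheory.GelbartRogawski1991.UnitaryDualPair.hasThetaMajorants_cmLineRep₁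
  Literature.NumberTheory.GelbartRogawski1991.UnitaryDualPair.hasThetaMajorants_cmLineRepFin₀
  Literature.NumberTheory.GelbartRogawski1991.UnitaryDualPair.hasThetaMajorants_cmLineRepFin₁
  Literature.NumberTheory.GelbartRogawski1991.UnitaryDualPair.hasThetaMajorants_omega_pairSmall₁_lineVec_of_signs
  Literature.NumberTheory.GelbartRogawski1991.UnitaryDualPair.hasThetaMajorants_omega_pairSmall₂_lineVec_of_signs
  Literature.NumberTheory.GelbartRogawski1991.UnitaryDualPair.hasThetaMajorants_cmLineRepFin₀_of_signs
  Literature.NumberTheory.GelbartRogawski1991.UnitaryDualPair.hasThetaMajorants_cmLineRepFin₁_of_signs
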